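import Summits.ABC.IUTFork.Repair.RHSlotReach
import Summits.ABC.IUTFork.Repair.RHHeightClass
import Literature.IUT.LogVolume.UnitLogValuationSpectrum
import Literature.IUT.LogVolume.RescaledCompletionInvariants
import HarnessLib

/-!
# R-H ROUND 1 (D-0079 «local-height condition I06⋆», D-0107), row 8 `heightclass` — the k2 KERNEL LEMMAS of the desk hand:
# «band cell ⟹ slot-reach cell» and the DATUM-LEVEL CERTIFICATES of the dictionary `(n₀, λ) = (1, −r/e)`

PROOF-ONLY file (D-0012: 0 definitions, 0 `Prop` facts; abc-iut cell, rung LADDER-ABC:A2.RP → A2.RESCUE.H; seat abc-iut-rp-m2 gen 5 =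
R-H «k2 DESK hand #8» of `plan/rescue/R-H/RH-CANDIDATES.tsv` v1.4 row 8 «heightclass», author abc-iut-lens-strengthen-1, CARD
`HOME/staging/RH/abc-iut-lens-strengthen-1/CARD-heightclass.md` 04b758c0530f1c16; abc-iut-rh-lead 16:57:50Z (1): «k2 rides row 15 (declared
HBand-cell ⟹ SlotReachWindow-cell); desk rp-m2 #8 only if that implication needs a kernel lemma»). TAKES NO SIDE on [IUTchIII] Cor. 3.12 or on
any author; every R-H candidate is a HYPOTHESIS (claim-tagged `def`), never a Literature fact; typed ≠ proved; instantiated ≠ endorsed.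

THE CANDIDATE (words; its `def`s `Repair.RHHeightClass.{StrictMinPow, CertVal, HBand}` are the author's, filed for the tree by the row's typer —
NOT restated here). At a bad place `w ∣ p` (`p` odd, uniform ramification `e` over `p`) and label `j = i+1`, in `𝔪_w`-units:
BAND CELL «`(j² − 1)·m_q(w) ≤ j·(e − r) + (1 − r)`» with `r` a DATUM-LEVEL certified member valuation of `log_p 𝒪_w^×`:
`StrictMinPow p e r` («`r = p^t − t·e` is the STRICT minimum of `t ↦ p^t − t·e`») or the fallback `r = e`.
Declared k2 route (door A2 (a) «cell ⟹ MOVER»): HBand-cell ⟹ SlotReachWindow-cell (abc-iut-lens-wuc-1's `Repair.RHSlotReach.SlotReachWindow`,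
tree, row 15) at the dictionary inner conductor `n₀ := 1`, outer radius `λ := −r/e`, realising orders `mΘ = j²·m_q` ⟹ multi-reach (row 15's k2
companion, abc-iut-rp-d3) ⟹ abc-iut-w5-d107 `Thm311.Real.qRegion_subset_thetaHull_settingDHVolSharp_of_multiReach` ⟹ `∃ ρ qK, QPinned ∧
PilotKummerCompatHull` at `settingPrVolSharp`. THIS FILE supplies the two row-8-specific kernel inputs of that chain, over TREE names only:

* §1 ARITHMETIC. `slotCell_of_bandCell` — for `e ≥ 1`, ANY inner-conductor bound `A ≥ 1` and outer exponent `B = r`: the band cell implies the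
  integer slot cell `e·⌊(j²·m_q − A)/e⌋ ≤ m_q − B + j·(e·⌈A/e⌉ − B)` of `RHSlotReach.clause_iff_uniform` / `slotReachWindowK_iff_cells_of_uniform`
  (so the declared implication holds at `A = 1` and a fortiori at every certified `A`); `bandCell_mono` (antitone in `r`); `bandCell_of_real`.
* §2 FIBRE LEVEL. `slotReachWindow_of_bandCells` — on uniform fibres (`e ≡ e_p`, `n₀ ≡ A_p ≥ 1`, `λ ≡ −B_p/e_p`, `mΘ = j²·m_q`) the band cells at
  the bad places give `SlotReachWindow` (ANY `lstar / Fib / bad`, i.e. the `hH` binder of the row-15 k2 theorem at any pilot datum `X`);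
  `slotReachWindowK_of_bandCells` — the same at the genuine `K`-level datum (`RHSlotReach.SlotReachWindowK`).
* §3 CERTIFICATES of the OUTER exponent `λ = −r/e` (any finite extension `K/ℚ_p`, then at the completions `kOf X p x`; the INNER bound
  `n₀ = 1` is certified at every place by the row-15 typer's `RHSlotReach.exists_norm_le_one_not_mem_logUnits` / `exists_hsharp_one` — CITED,
  not restated). (b) `strictTurning_of_strictMin` — the candidate's «STRICT minimum of `t ↦ p^t − t·e` at `t`» IS the strict turning point of
  abc-iut-c312-3's `UnitLogMaxNorm` (`p^a(p−1) < e` for `a < t`, `e < p^t(p−1)`) — the bridge between `StrictMinPow` and the turning-point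
  binders `hlo`/`hhi` of `RHSlotReach.exists_hrad_sharp`; hence `exists_mem_logUnits_norm_eq_zpow_of_strictMin` — **`∃ z ∈ log_p 𝒪^×,
  ‖z‖ = ‖ϖ‖^r`** (`z = log_p(1+ϖ)`, `LogEnvelope.exists_mem_logUnits_norm_eq_envelope`); (c) `exists_mem_logUnits_norm_eq_pow_div_succ` —
  `ϖ^{⌊e/(p−1)⌋+1} ∈ log_p 𝒪^×` at EVERY `(p, e)` (`LogEnvelope.closedBall_div_succ_subset_logUnits`), which certifies the candidate's fallback
  `r = e` for `p` odd (`exists_mem_logUnits_norm_prime_le`: `⌊e/(p−1)⌋+1 ≤ e`) and records the free sharpening `r = ⌊e/(p−1)⌋+1` (a census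
  variant for the author, not adopted here); `exists_mem_logUnits_zpow_le_of_certVal` — «`StrictMinPow p e r ∨ r = e` (UNFOLDED) ⟹
  `∃ z ∈ log_p 𝒪^×, ‖ϖ‖^r ≤ ‖z‖`»; (d) the `rpow` form at a place `x ∣ p` of a Dupuy–Hilado pilot datum, `e = ramIdx F (placeOf X p x)`
  (`absRamificationIdx_kOf`): `exists_mem_logUnits_rpow_le_of_certVal` — «`CertVal` ⟹ `∃ z ∈ log_p 𝒪_x^×, p^{−r/e} ≤ ‖z‖`», the `hrad` binder
  shape of row 15's glue at `λ = −r/e`.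

HONEST SCOPE. Nothing here evaluates the candidate on the table (k1 is abc-iut-rh-num-1's), nothing asserts the band cell at any genuine datum, and
the mover lemma of row 15 is NOT proved here (abc-iut-rp-d3's companion). Classical local-field facts (Neukirch II (5.5); [IUTchIV] Prop. 1.2 (i),
1.4 (ii) as kernel-checked in the tree) + integer arithmetic; standard axioms. [cite: NeukirchANT1999, Ch. II Prop. (5.5)]
[cite: Mochizuki2012, IUTchIV Prop. 1.2 (i) p. 10, Prop. 1.4 (ii) p. 13; IUTchIII Thm. 3.11 (i) (Ind2) p. 154] [cite: DupuyHilado2025, §3.3, §4.9]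
[claim: Mochizuki2012, status: disputed] for every IUT locution.
-/

noncomputable section

open Set Metric Function
open scoped Pointwise

namespace Summit.ABC.IUTFork.Repair.RHHeightClassGlue

/-! ## §1. Arithmetic: the band cell implies the slot-reach cell -/

/-- `1 ≤ ⌈A/e⌉ = −⌊−A/e⌋` for `1 ≤ A`, `1 ≤ e`. [folklore] -/
theorem one_le_ceilDiv {e A : ℤ} (he : 1 ≤ e) (hA : 1 ≤ A) : 1 ≤ -((-A) / e) := by
  have h2 := RHSlotReach.le_mul_ceilDiv he A
  by_contra hlt
  rw [not_le] at hlt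
  have : e * (-((-A) / e)) ≤ 0 := by nlinarith
  linarith

/-- **BAND CELL ⟹ SLOT CELL** (integers, `𝔪_w`-units, label `j = i+1`). For `e ≥ 1`, ANY inner-conductor bound `A ≥ 1` and outer exponent `B`:
«`(j²−1)·m_q ≤ j·(e − B) + (1 − B)`» implies «`e·⌊(j²·m_q − A)/e⌋ ≤ m_q − B + j·(e·⌈A/e⌉ − B)`» — the `(w, j)` integer cell of
`RHSlotReach.slotReachWindowK_iff_cells_of_uniform` (`e·⌊x/e⌋ ≤ x`, `A ≥ 1`, `e·⌈A/e⌉ ≥ e`). This is abc-iut-lens-strengthen-1's declared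
implication «HBand-cell ⟹ SlotReachWindow-cell» (CARD-heightclass: floor dropped, `A := 1`, `B := r`). [folklore] -/
theorem slotCell_of_bandCell {e A : ℕ} {B mq : ℤ} (he : 1 ≤ e) (hA : 1 ≤ A) (i : ℕ)
    (hband : (((i : ℤ) + 1) ^ 2 - 1) * mq ≤ ((i : ℤ) + 1) * ((e : ℤ) - B) + (1 - B)) :
    (e : ℤ) * (((((i : ℤ) + 1) ^ 2) * mq - A) / (e : ℤ)) ≤
      mq - B + (((i + 1 : ℕ)) : ℤ) * ((e : ℤ) * (-((-(A : ℤ)) / (e : ℤ))) - B) := by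
  have he' : (1 : ℤ) ≤ (e : ℤ) := by exact_mod_cast he
  have hA' : (1 : ℤ) ≤ (A : ℤ) := by exact_mod_cast hA
  have h1 := RHSlotReach.mul_ediv_le_self he' ((((i : ℤ) + 1) ^ 2) * mq - A)
  have hC1 : 1 ≤ -((-(A : ℤ)) / (e : ℤ)) := one_le_ceilDiv he' hA'
  have h3 : (e : ℤ) ≤ (e : ℤ) * (-((-(A : ℤ)) / (e : ℤ))) := by nlinarith
  have hj : (0 : ℤ) ≤ (i : ℤ) + 1 := by positivity
  have h4 : ((i : ℤ) + 1) * ((e : ℤ) - B) ≤ ((i : ℤ) + 1) * ((e : ℤ) * (-((-(A : ℤ)) / (e : ℤ))) - B) :=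
    mul_le_mul_of_nonneg_left (by linarith) hj
  push_cast
  linarith

/-- The band cell is ANTITONE in the certified exponent: a smaller `r` (a LARGER certified member `‖ϖ‖^r` of `log_p 𝒪^×`) only helps. [folklore] -/
theorem bandCell_mono {e B B' mq : ℤ} (i : ℕ) (hB : B' ≤ B)
    (hband : (((i : ℤ) + 1) ^ 2 - 1) * mq ≤ ((i : ℤ) + 1) * (e - B) + (1 - B)) :
    (((i : ℤ) + 1) ^ 2 - 1) * mq ≤ ((i : ℤ) + 1) * (e - B') + (1 - B') := by
  have hj : (0 : ℤ) ≤ (i : ℤ) + 1 := by positivity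
  nlinarith

/-- The REAL-valued band cell of the candidate (`m_q = X.qPilot w ∈ ℝ`) at an INTEGER Kummer order `m_q = M` (genuine data: `2l ∣ ord_w(q)`,
`PilotData.two_mul_l_dvd_ordq_of_jE_eq`) is the integer band cell. [folklore] -/
theorem bandCell_of_real {e B M : ℤ} (i : ℕ) {mq : ℝ} (hmq : mq = (M : ℝ))
    (hband : ((((i : ℕ) : ℝ) + 1) ^ 2 - 1) * mq ≤ (((i : ℕ) : ℝ) + 1) * ((e : ℝ) - B) + (1 - B)) :
    (((i : ℤ) + 1) ^ 2 - 1) * M ≤ ((i : ℤ) + 1) * (e - B) + (1 - B) := by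
  rw [hmq] at hband
  exact_mod_cast hband

/-! ## §2. Fibre level: band cells at the bad places ⟹ `SlotReachWindow` on uniform fibres -/

/-- **BAND CELLS ⟹ `SlotReachWindow`** (any `lstar`, fibres `Fib`, bad-place predicate `bad` — e.g. the packets of ANY Dupuy–Hilado pilot datum
`X`, `bad := placeOf w ∈ X.S`, the `hH` binder of row 15's k2 theorem). Dictionary UNIFORM per prime: `e ≡ e_p ≥ 1`, inner-conductor bound
`n₀ ≡ A_p ≥ 1` (the candidate: `A_p = 1`), outer radius `λ ≡ −B_p/e_p` (the candidate: `B_p = r`), realising Θ-orders `mΘ(j, w) = j²·m_q(w)`;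
hypothesis: the band cell at every bad place and label. [folklore] -/
theorem slotReachWindow_of_bandCells {lstar : ℕ} {Fib : Nat.Primes → Type} {bad : ∀ pp, Fib pp → Prop}
    (eK AK : Nat.Primes → ℕ) (BK : Nat.Primes → ℤ) (heK : ∀ pp, 1 ≤ eK pp) (hAK : ∀ pp, 1 ≤ AK pp)
    {e n₀ : ∀ pp, Fib pp → ℕ} {lam : ∀ pp, Fib pp → ℝ} {mΘ : ∀ pp, Fin lstar → Fib pp → ℤ} {mq : ∀ pp, Fib pp → ℤ}
    (he : ∀ pp x, e pp x = eK pp) (hn₀ : ∀ pp x, n₀ pp x = AK pp)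
    (hlam : ∀ pp x, lam pp x = -((BK pp : ℤ) : ℝ) / ((eK pp : ℕ) : ℝ))
    (hmΘ : ∀ pp i w, mΘ pp i w = ((((i : ℕ) : ℤ) + 1) ^ 2) * mq pp w)
    (hband : ∀ (pp : Nat.Primes) (i : Fin lstar) (w : Fib pp), bad pp w →
      ((((i : ℕ) : ℤ) + 1) ^ 2 - 1) * mq pp w ≤ (((i : ℕ) : ℤ) + 1) * ((eK pp : ℤ) - BK pp) + (1 - BK pp)) :
    RHSlotReach.SlotReachWindow lstar Fib bad e n₀ lam mΘ mq := by
  intro pp i w hw x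
  simp only [he, hn₀, hlam, hmΘ]
  rw [RHSlotReach.clause_iff_uniform (eK pp) (heK pp) (AK pp) (BK pp) (i : ℕ) _ (mq pp w)]
  exact slotCell_of_bandCell (heK pp) (hAK pp) (i : ℕ) (hband pp i w hw)

section Genuine

open NumberField IsDedekindDomain Literature.IUT.LogVolume Literature.IUT.HodgeTheaters Summit.ABC.IUTFork.Thm311
  Summit.ABC.IUTFork.Thm311.Real Summit.ABC.IUTFork.Cor312 Summit.ABC.IUTFork.Cor312Prov

variable {F K Fbar : Type} [Field F] [NumberField F] [Field K] [NumberField K] [Algebra F K] [Field Fbar]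
  [Algebra F Fbar] [Algebra K Fbar] {E : WeierstrassCurve F} [E.IsElliptic] {l : ℕ} {Pb : BadPlacePredicates K}
  (D : InitialThetaData F K Fbar E l Pb)

/-- **BAND CELLS ⟹ ROW 15 AT THE GENUINE `K`-LEVEL DATUM** (`RHSlotReach.SlotReachWindowK`, the `hH` binder at `X := pilotDataOfK D K`):
uniform certified data `(e_p, A_p ≥ 1, B_p)` per prime, realising profile `mΘ = j²·m_q`, band cell at every bad `w ∣ p` and label —
via abc-iut-rh-typ-12's k1 evaluation lemma `slotReachWindowK_iff_cells_of_uniform` and §1. [folklore] -/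
theorem slotReachWindowK_of_bandCells (eK AK : Nat.Primes → ℕ) (BK : Nat.Primes → ℤ) (heK : ∀ pp, 1 ≤ eK pp) (hAK : ∀ pp, 1 ≤ AK pp)
    (e n₀ : ∀ pp : Nat.Primes, (thetaIndex (pilotDataOfK D K)).Fibre (.inr pp) → ℕ)
    (lam : ∀ pp : Nat.Primes, (thetaIndex (pilotDataOfK D K)).Fibre (.inr pp) → ℝ)
    (mΘ : ∀ pp : Nat.Primes, Fin (thetaIndex (pilotDataOfK D K)).lstar → (thetaIndex (pilotDataOfK D K)).Fibre (.inr pp) → ℤ)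
    (mq : ∀ pp : Nat.Primes, (thetaIndex (pilotDataOfK D K)).Fibre (.inr pp) → ℤ)
    (he : ∀ pp x, e pp x = eK pp) (hn₀ : ∀ pp x, n₀ pp x = AK pp)
    (hlam : ∀ pp x, lam pp x = -((BK pp : ℤ) : ℝ) / ((eK pp : ℕ) : ℝ))
    (hmΘ : ∀ pp i w, mΘ pp i w = ((((i : ℕ) : ℤ) + 1) ^ 2) * mq pp w)
    (hband : ∀ (pp : Nat.Primes) (i : Fin (thetaIndex (pilotDataOfK D K)).lstar) (w : (thetaIndex (pilotDataOfK D K)).Fibre (.inr pp)),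
      (haveI : Fact (pp : ℕ).Prime := ⟨pp.2⟩; placeOf (pilotDataOfK D K) pp.1 w ∈ (pilotDataOfK D K).S) →
        ((((i : ℕ) : ℤ) + 1) ^ 2 - 1) * mq pp w ≤ (((i : ℕ) : ℤ) + 1) * ((eK pp : ℤ) - BK pp) + (1 - BK pp)) :
    RHSlotReach.SlotReachWindowK D e n₀ lam mΘ mq :=
  (RHSlotReach.slotReachWindowK_iff_cells_of_uniform D eK AK BK heK e n₀ lam mΘ mq he hn₀ hlam hmΘ).2
    fun pp i w hw => slotCell_of_bandCell (heK pp) (hAK pp) (i : ℕ) (hband pp i w hw)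

end Genuine

/-! ## §3. The datum-level certificates of the outer exponent `λ = −r/e` (`n₀ = 1`: `RHSlotReach.exists_hsharp_one`, cited) -/

section LocalField

open Literature.IUT.LogVolume Literature.NumberTheory.GaloisRepresentations.Ultrametric

variable (p : ℕ) [hp : Fact p.Prime] {K : Type*} [NontriviallyNormedField K] [instK : NormedAlgebra ℚ_[p] K] [IsUltrametricDist K]
  [ProperSpace K]

omit hp in
/-- **The candidate's `StrictMinPow` IS the strict turning point of `UnitLogMaxNorm`.** If `r = p^t − t·e` is the STRICT minimum of
`t' ↦ p^{t'} − t'·e` over `ℕ`, then `p^a·(p−1) < e` for every `a < t` and `e < p^t·(p−1)` (compare the values at `t − 1` and `t + 1`;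
`a ↦ p^a` is monotone). Pure arithmetic, `p ≥ 1`. [cite: NeukirchANT1999, Ch. II Prop. (5.5)] -/
theorem strictTurning_of_strictMin {p e : ℕ} (hp1 : 1 ≤ p) {r : ℤ} {t : ℕ} (ht : (p : ℤ) ^ t - t * e = r)
    (hs : ∀ t' : ℕ, t' ≠ t → r < (p : ℤ) ^ t' - t' * e) :
    (∀ a < t, (p : ℤ) ^ a * ((p : ℤ) - 1) < e) ∧ ((e : ℤ) < (p : ℤ) ^ t * ((p : ℤ) - 1)) := by
  have hp1' : (1 : ℤ) ≤ (p : ℤ) := by exact_mod_cast hp1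
  constructor
  · intro a ha
    obtain ⟨s, rfl⟩ : ∃ s, t = s + 1 := ⟨t - 1, by omega⟩
    have h := hs s (by omega)
    rw [← ht, pow_succ] at h
    push_cast at h
    have hkey : (p : ℤ) ^ s * ((p : ℤ) - 1) < e := by nlinarith
    have hmono : (p : ℤ) ^ a ≤ (p : ℤ) ^ s := pow_le_pow_right₀ hp1' (by omega)
    nlinarith
  · have h := hs (t + 1) (by omega)
    rw [← ht, pow_succ] at h
    push_cast at h
    nlinarith

variable {ϖ : Kˣ} (hϖ : IsUniformizer ϖ)
include hϖ

/-- **`StrictMinPow p e r` certifies a unit logarithm of norm EXACTLY `‖ϖ‖^r`** (`e = e(K/ℚ_p)`): `z = log_p(1 + ϖ)` — abc-iut-c312-3's exact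
envelope `LogEnvelope.exists_mem_logUnits_norm_eq_envelope` at the strict turning point supplied by `strictTurning_of_strictMin`.
The candidate's `StrictMinPow` is consumed UNFOLDED (binders `ht`, `hs`), so `obtain ⟨t, ht, hs⟩ := h` composes by `exact`.
[cite: NeukirchANT1999, Ch. II Prop. (5.5)] -/
theorem exists_mem_logUnits_norm_eq_zpow_of_strictMin {r : ℤ} {t : ℕ}
    (ht : (p : ℤ) ^ t - t * (absRamificationIdx p K) = r)
    (hs : ∀ t' : ℕ, t' ≠ t → r < (p : ℤ) ^ t' - t' * (absRamificationIdx p K)) :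
    ∃ z ∈ logUnits K, ‖z‖ = ‖(ϖ : K)‖ ^ r := by
  obtain ⟨hlo, hhi⟩ := strictTurning_of_strictMin hp.out.one_lt.le ht hs
  obtain ⟨z, hz, hzn⟩ := LogEnvelope.exists_mem_logUnits_norm_eq_envelope p hϖ hlo hhi
  refine ⟨z, hz, ?_⟩
  rw [hzn, ← ht]
  congr 1
  ring

/-- **`ϖ^{⌊e/(p−1)⌋+1} ∈ log_p(𝒪_K^×)` at EVERY `(p, e)`** (abc-iut-c312-3 `LogEnvelope.closedBall_div_succ_subset_logUnits`, Neukirch II (5.5):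
`log_p` maps `U^{(n)}` onto `𝔭ⁿ` for `n > e/(p−1)`): a certified member of exponent `⌊e/(p−1)⌋+1`, ties included — the free sharpening of the
candidate's fallback recorded for the author's census (NOT adopted by this file). [cite: NeukirchANT1999, Ch. II Prop. (5.5)] -/
theorem exists_mem_logUnits_norm_eq_pow_div_succ :
    ∃ z ∈ logUnits K, ‖z‖ = ‖(ϖ : K)‖ ^ (absRamificationIdx p K / (p - 1) + 1) :=
  ⟨(ϖ : K) ^ (absRamificationIdx p K / (p - 1) + 1),
    LogEnvelope.closedBall_div_succ_subset_logUnits p hϖ (by rw [mem_closedBall_zero_iff, norm_pow]), norm_pow _ _⟩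

/-- **The fallback `r = e` is certified for `p` odd**: some unit logarithm has norm `≥ ‖ϖ‖^e = ‖p‖` (indeed `ϖ^{⌊e/(p−1)⌋+1}`, and
`⌊e/(p−1)⌋ + 1 ≤ e` when `p ≥ 3`). [cite: NeukirchANT1999, Ch. II Prop. (5.5)] -/
theorem exists_mem_logUnits_norm_prime_le (hp2 : 2 < p) :
    ∃ z ∈ logUnits K, ‖(ϖ : K)‖ ^ ((absRamificationIdx p K : ℕ) : ℤ) ≤ ‖z‖ := by
  obtain ⟨z, hz, hzn⟩ := exists_mem_logUnits_norm_eq_pow_div_succ p hϖ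
  refine ⟨z, hz, ?_⟩
  rw [hzn, zpow_natCast]
  have he1 : 1 ≤ absRamificationIdx p K := absRamificationIdx_pos p K
  have hle : absRamificationIdx p K / (p - 1) + 1 ≤ absRamificationIdx p K := by
    have h2 : absRamificationIdx p K / (p - 1) ≤ absRamificationIdx p K / 2 := Nat.div_le_div_left (by omega) (by omega)
    omega
  exact pow_le_pow_of_le_one (norm_nonneg _) hϖ.1.le hle

/-- **`CertVal p e r` (= `StrictMinPow p e r ∨ r = e`, UNFOLDED) certifies a unit logarithm of norm `≥ ‖ϖ‖^r`** for `p` odd. [folklore] -/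
theorem exists_mem_logUnits_zpow_le_of_certVal (hp2 : 2 < p) {r : ℤ}
    (hcert : (∃ t : ℕ, (p : ℤ) ^ t - t * (absRamificationIdx p K) = r ∧
        ∀ t' : ℕ, t' ≠ t → r < (p : ℤ) ^ t' - t' * (absRamificationIdx p K)) ∨ r = absRamificationIdx p K) :
    ∃ z ∈ logUnits K, ‖(ϖ : K)‖ ^ r ≤ ‖z‖ := by
  rcases hcert with ⟨t, ht, hs⟩ | rfl
  · obtain ⟨z, hz, hzn⟩ := exists_mem_logUnits_norm_eq_zpow_of_strictMin p hϖ ht hs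
    exact ⟨z, hz, hzn.ge⟩
  · exact exists_mem_logUnits_norm_prime_le p hϖ hp2

end LocalField

/-! ## §3 (d). At a place `x ∣ p` of a pilot datum: the `rpow` forms with `e = ramIdx F (placeOf X p x)` -/

section Place

open NumberField IsDedekindDomain Literature.IUT.LogVolume Literature.NumberTheory.GaloisRepresentations.Ultrametric
  Summit.ABC.IUTFork.Thm311 Summit.ABC.IUTFork.Thm311.Real

variable {F : Type} [Field F] [NumberField F] (X : PilotData F) (p : ℕ) [hp : Fact p.Prime]

/-- `e(K_x/ℚ_p) = ramIdx F (placeOf x)` for the rescaled completion at a place `x ∣ p` of the Θ-index fibre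
(`absRamificationIdx_rescaledCompletion`, `ramIdx_eq`). [cite: NeukirchANT1999, Ch. II Prop. (6.8)] -/
theorem absRamificationIdx_kOf (x : (thetaIndex X).Fibre (.inr (ratPrime p))) :
    absRamificationIdx p (kOf X p x) = ramIdx F (placeOf X p x) := by
  rw [ramIdx_eq]
  exact absRamificationIdx_rescaledCompletion F p (placeOf X p x) (natCast_mem_placeOf X p x)

/-- **`hrad` at `λ = −r/e` from the candidate's certificate** (`p` odd): if `StrictMinPow p e r ∨ r = e` (UNFOLDED; `e = ramIdx F (placeOf x)`),
then some `z ∈ log_p 𝒪_x^×` has `p^{−r/e} ≤ ‖z‖` (`‖ϖ_x‖ = p^{−1/e}`, `exists_isUniformizer_rescaledCompletion`).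
[cite: NeukirchANT1999, Ch. II Prop. (5.5), Prop. (6.8)] -/
theorem exists_mem_logUnits_rpow_le_of_certVal (hp2 : 2 < p) (x : (thetaIndex X).Fibre (.inr (ratPrime p))) {r : ℤ}
    (hcert : (∃ t : ℕ, (p : ℤ) ^ t - t * (ramIdx F (placeOf X p x)) = r ∧
        ∀ t' : ℕ, t' ≠ t → r < (p : ℤ) ^ t' - t' * (ramIdx F (placeOf X p x))) ∨ r = ramIdx F (placeOf X p x)) :
    ∃ z ∈ (logUnits (kOf X p x) : Set (kOf X p x)), (p : ℝ) ^ (-(r : ℝ) / (ramIdx F (placeOf X p x) : ℝ)) ≤ ‖z‖ := by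
  obtain ⟨ϖ, hϖ, hnorm⟩ := exists_isUniformizer_rescaledCompletion F p (placeOf X p x) (natCast_mem_placeOf X p x)
  have he := absRamificationIdx_kOf X p x
  rw [← he] at hcert
  obtain ⟨z, hz, hle⟩ := exists_mem_logUnits_zpow_le_of_certVal p hϖ hp2 hcert
  refine ⟨z, hz, le_trans (le_of_eq ?_) hle⟩
  have hp0 : (0 : ℝ) ≤ p := by positivity
  have he' : ((placeOf X p x).asIdeal.ramificationIdx ℤ : ℝ) = (ramIdx F (placeOf X p x) : ℝ) := by
    rw [ramIdx_eq]
  rw [hnorm, ← Real.rpow_intCast, ← Real.rpow_mul hp0, he']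
  congr 1
  have hne : (ramIdx F (placeOf X p x) : ℝ) ≠ 0 := by exact_mod_cast ramIdx_ne_zero F (placeOf X p x)
  field_simp

end Place

end Summit.ABC.IUTFork.Repair.RHHeightClassGlue

/-! ## §4. (APPENDED 2026-08-26, v2) `HBand X` ⟹ `SlotReachWindow` AT THE CANDIDATE'S DICTIONARY — the row-8 half of the k2 chain, assembled

With the typer's `Repair.RHHeightClass.HBand` (abc-iut-rh-typ-8, p459046; §T2 `le_of_certVal_of_strictMin` / `bandCell_of_le`) now in the tree, the
declared implication is stated ON THE CANDIDATE ITSELF: for ANY Dupuy–Hilado pilot datum `X` and any numeric dictionary `(e, n₀, λ, mΘ, m_q)` of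
row 15's k2 theorem that READS the candidate — `e ≡ e_p` uniform on each fibre and equal to `ramIdx` at the bad places, `n₀ ≡ 1`, `λ ≡ −r_p/e_p`
with `r_p` a LOWER BOUND of the certified values `CertVal p e_p` at the primes under bad places (untied: `r_p = r♯`, by
`RHHeightClass.le_of_certVal_of_strictMin`; tied: `r_p = e_p`), INTEGER Kummer orders `m_q(w) = P_q(w)` (genuine data: `2l ∣ ord_w(q_w)`,
`PilotData.two_mul_l_dvd_ordq_of_jE_eq`) and realising Θ-orders `mΘ = j²·m_q` — **`HBand X ⟹ SlotReachWindow`** (`slotReachWindow_of_hBand`).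
Also the last certificate building block in `rpow` form at every place (any `p`, ties and `p = 2` included): `exists_mem_logUnits_rpow_le_div_succ`
(`ϖ^{⌊e/(p−1)⌋+1} ∈ log_p 𝒪_x^×`), for the dictionary's `λ` at fibres WITHOUT bad places, where the candidate is silent. What remains of row 8's k2
after this file is exactly row 15's mover lemma (abc-iut-rp-d3) — «k2 rides row 15», as declared. -/

namespace Summit.ABC.IUTFork.Repair.RHHeightClassGlue

section HBand

open NumberField IsDedekindDomain Literature.IUT.LogVolume Literature.NumberTheory.GaloisRepresentations.Ultrametric
  Summit.ABC.IUTFork.Thm311 Summit.ABC.IUTFork.Thm311.Real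

variable {F : Type} [Field F] [NumberField F] (X : PilotData F)

/-- **`HBand X` ⟹ `SlotReachWindow` at the candidate's dictionary** (`n₀ ≡ 1`, `λ ≡ −r_p/e_p`, `mΘ = j²·m_q`, integer `m_q = P_q` at the bad
places, `e_p = ramIdx` at the bad places, `r_p ≤` every certified value at `(p, e_p)`). Per bad cell: the candidate's `∃ r, CertVal ∧ band(r)`,
antitonicity in `r` (`RHHeightClass.bandCell_of_le`), the real-to-integer cast (`bandCell_of_real`), then §2 `slotReachWindow_of_bandCells` at
`A = 1`. [claim: Mochizuki2012, status: disputed] for the candidate; the implication is bookkeeping + §1 arithmetic. -/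
theorem slotReachWindow_of_hBand (eK : Nat.Primes → ℕ) (rK : Nat.Primes → ℤ) (heK : ∀ pp, 1 ≤ eK pp)
    {e n₀ : ∀ pp : Nat.Primes, (thetaIndex X).Fibre (.inr pp) → ℕ}
    {lam : ∀ pp : Nat.Primes, (thetaIndex X).Fibre (.inr pp) → ℝ}
    {mΘ : ∀ pp : Nat.Primes, Fin (thetaIndex X).lstar → (thetaIndex X).Fibre (.inr pp) → ℤ}
    {mq : ∀ pp : Nat.Primes, (thetaIndex X).Fibre (.inr pp) → ℤ}
    (he : ∀ pp x, e pp x = eK pp) (hn₀ : ∀ pp x, n₀ pp x = 1)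
    (hlam : ∀ pp x, lam pp x = -((rK pp : ℤ) : ℝ) / ((eK pp : ℕ) : ℝ))
    (hmΘ : ∀ pp i w, mΘ pp i w = ((((i : ℕ) : ℤ) + 1) ^ 2) * mq pp w)
    (hram : ∀ (pp : Nat.Primes) (w : (thetaIndex X).Fibre (.inr pp)), haveI : Fact (pp : ℕ).Prime := ⟨pp.2⟩
      placeOf X pp.1 w ∈ X.S → ramIdx F (placeOf X pp.1 w) = eK pp)
    (hmq : ∀ (pp : Nat.Primes) (w : (thetaIndex X).Fibre (.inr pp)), haveI : Fact (pp : ℕ).Prime := ⟨pp.2⟩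
      placeOf X pp.1 w ∈ X.S → (mq pp w : ℝ) = X.qPilot (placeOf X pp.1 w))
    (hrK : ∀ (pp : Nat.Primes) (w : (thetaIndex X).Fibre (.inr pp)), haveI : Fact (pp : ℕ).Prime := ⟨pp.2⟩
      placeOf X pp.1 w ∈ X.S → ∀ r : ℤ, RHHeightClass.CertVal pp (eK pp) r → rK pp ≤ r)
    (hH : RHHeightClass.HBand X) :
    RHSlotReach.SlotReachWindow (thetaIndex X).lstar (fun pp => (thetaIndex X).Fibre (.inr pp))
      (fun pp w => haveI : Fact (pp : ℕ).Prime := ⟨pp.2⟩; placeOf X pp.1 w ∈ X.S) e n₀ lam mΘ mq := by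
  refine slotReachWindow_of_bandCells eK (fun _ => 1) rK heK (fun _ => le_rfl) he hn₀ hlam hmΘ fun pp i w hw => ?_
  haveI : Fact (pp : ℕ).Prime := ⟨pp.2⟩
  have hw' : placeOf X pp.1 w ∈ X.S := hw
  obtain ⟨-, -, r, hcert, hcell⟩ := hH pp i w hw'
  rw [hram pp w hw'] at hcert hcell
  have hle : ((rK pp : ℤ) : ℝ) ≤ (r : ℝ) := by exact_mod_cast hrK pp w hw' r hcert
  have hc : (0 : ℝ) ≤ ((i : ℕ) : ℝ) + 1 := by positivity
  have hcell' := RHHeightClass.bandCell_of_le hc hle hcell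
  rw [← hmq pp w hw'] at hcell'
  exact_mod_cast hcell'

/-- **The UNTIED case of the dictionary's exponent**: if `r_p` is a strict minimum at `(p, e_p)` (column `r_out_sharp`, no `(tie)` flag), it is a lower
bound of every certified value there (`RHHeightClass.le_of_certVal_of_strictMin`) — the `hrK` binder of `slotReachWindow_of_hBand`. [folklore] -/
theorem hrK_of_strictMinPow (eK : Nat.Primes → ℕ) (rK : Nat.Primes → ℤ) (heK : ∀ pp, 1 ≤ eK pp)
    (hsharp : ∀ pp : Nat.Primes, RHHeightClass.StrictMinPow pp (eK pp) (rK pp)) (pp : Nat.Primes) (r : ℤ)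
    (hr : RHHeightClass.CertVal pp (eK pp) r) : rK pp ≤ r :=
  RHHeightClass.le_of_certVal_of_strictMin (heK pp) (hsharp pp) hr

/-- **The TIED case**: with the fallback `r_p = e_p` every certified value is `≥ r♯` or `= e_p`; since a strict minimum is `≤ 1 ≤ e_p`
(`RHHeightClass.strictMinPow_le_one`) the bound `min(r♯, e_p) ≤ r` needs `r♯` — so at a tied place (NO strict minimum exists) `CertVal` forces
`r = e_p` and `r_p := e_p` is the lower bound. [folklore] -/
theorem hrK_of_tie {p e : ℕ} (htie : ∀ r : ℤ, ¬ RHHeightClass.StrictMinPow p e r) (r : ℤ) (hr : RHHeightClass.CertVal p e r) :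
    (e : ℤ) ≤ r := by
  rcases hr with hr | hr
  · exact absurd hr (htie r)
  · rw [hr]

end HBand

section PlaceAnyPrime

open NumberField IsDedekindDomain Literature.IUT.LogVolume Literature.NumberTheory.GaloisRepresentations.Ultrametric
  Summit.ABC.IUTFork.Thm311 Summit.ABC.IUTFork.Thm311.Real

variable {F : Type} [Field F] [NumberField F] (X : PilotData F) (p : ℕ) [hp : Fact p.Prime]

/-- **A certified outer exponent at EVERY place, every `p` (ties and `p = 2` included)**: with `e = ramIdx F (placeOf x)`, some
`z ∈ log_p 𝒪_x^×` has `p^{−(⌊e/(p−1)⌋+1)/e} ≤ ‖z‖` (`z = ϖ_x^{⌊e/(p−1)⌋+1}`, §3 (c)) — the `hrad` binder at `λ_x = −(⌊e/(p−1)⌋+1)/e` for the fibres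
where the candidate is silent (no bad place). [cite: NeukirchANT1999, Ch. II Prop. (5.5), Prop. (6.8)] -/
theorem exists_mem_logUnits_rpow_le_div_succ (x : (thetaIndex X).Fibre (.inr (ratPrime p))) :
    ∃ z ∈ (logUnits (kOf X p x) : Set (kOf X p x)),
      (p : ℝ) ^ (-(((ramIdx F (placeOf X p x) / (p - 1) + 1 : ℕ) : ℝ)) / (ramIdx F (placeOf X p x) : ℝ)) ≤ ‖z‖ := by
  obtain ⟨ϖ, hϖ, hnorm⟩ := exists_isUniformizer_rescaledCompletion F p (placeOf X p x) (natCast_mem_placeOf X p x)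
  obtain ⟨z, hz, hzn⟩ := exists_mem_logUnits_norm_eq_pow_div_succ p hϖ
  rw [absRamificationIdx_kOf X p x] at hzn
  refine ⟨z, hz, le_of_eq ?_⟩
  have hp0 : (0 : ℝ) ≤ p := by positivity
  have he' : ((placeOf X p x).asIdeal.ramificationIdx ℤ : ℝ) = (ramIdx F (placeOf X p x) : ℝ) := by
    rw [ramIdx_eq]
  rw [hzn, hnorm, ← Real.rpow_natCast, ← Real.rpow_mul hp0, he']
  congr 1
  have hne : (ramIdx F (placeOf X p x) : ℝ) ≠ 0 := by exact_mod_cast ramIdx_ne_zero F (placeOf X p x)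
  field_simp

end PlaceAnyPrime

end Summit.ABC.IUTFork.Repair.RHHeightClassGlue

end
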